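import Summits.Ventures.QEC.Census.Calib.CalibRows01
import Literature.InformationTheory.QuantumCodes.ConcatenationDepolarizing
import Literature.InformationTheory.QuantumCodes.ConcatenatedCodes
import Literature.InformationTheory.QuantumCodes.CSSStabilizer
import Literature.InformationTheory.QuantumCodes.CodeCapacityNoise
import HarnessLib

/-!
# The concatenated Steane family `[[7^k, 1, 3^k]]` and its code-capacity thresholds under hierarchical decoding:
# `1/21` per sector, `1/14` depolarizing (sector-wise) — the Q5 concatenation row NAMES A CODE

Venture QEC, `Summits/Ventures/QEC/Thresholds/` (LADDER-QEC rung Q5; PARTITION item 03.CONCAT2, lead block 58 (8)). This file ties the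
three Literature theorems of the concatenation mechanism (`ConcatenationBadnessRecursion.lean`: AGP06 Lemma 2 from independence;
`ConcatenationHierarchicalDecoding.lean`: the recursive decoder fails only on bad patterns; `ConcatenationDepolarizing.lean`: both sectors under
depolarizing noise) to the census's KERNEL-certified Steane code `cal_Steane7` (`[[7,1,3]]`, `Census/Calib/CalibRows01.lean`):

* **`concatenatedSteane_exists`** — the census Steane row (`cal_Steane7.isCode`, read as a CRSS additive code by
  `CSSCode.IsCode.isAdditiveCode`) concatenated with itself `L` times gives a
  `[[7^(L+1), 1, 3^(L+1)]]` code (Gottesman 1997 §3.5, the tree's `AdditiveCodeExists.concatPow`): the code family of the row;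
* **`steaneSector_spec`** (kernel `decide`) — the block decoder `AGP06.steaneSector` IS Hamming-syndrome decoding of ONE SECTOR OF THE
  CENSUS STEANE CODE: for every flip pattern `b` on the `7` qubits, the residual (flip back the position named by the syndrome) has zero syndrome on all three census check rows `cal_Steane7.cert.HZ` (it is a normaliser element of the sector), and `steaneSector b = true` iff the residual is NOT in the row space of the census check rows `cal_Steane7.cert.HX` (it is a logical
  operator, not a stabilizer) — i.e. iff sector decoding of the block leaves a logical flip;
* the thresholds of the family under level-by-level (hierarchical) decoding, code-capacity model, as LIMIT statements (failure
  probability `→ 0` as the level `k → ∞`; the explicit double-exponential bounds are the Literature theorems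
  `AGP06.flipProb_steaneSector_le` / `AGP06.depolFailProb_steane_le`): **`concatenatedSteane_sector_threshold`** — independent flips of
  rate `p < 1/21` in a sector; **`concatenatedSteane_depolarizing_threshold`** — i.i.d. depolarizing noise of rate `p < 1/14`, both sectors
  decoded separately; helper `tendsto_zero_of_le_doubleExp`; and (appended) the same in the tree's Q5 vocabulary: families
  `concatenatedSteaneSectorFamily` / `concatenatedSteaneDepolarizingFamily` (size index = level `k`), `IsThresholdLowerBound … (1/21)` /
  `… (1/14)`, **`accuracyThreshold ≥ 1/21`** / **`≥ 1/14`**, `DecaysExponentially` below `1/14`.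

HONEST FRAMING: code-capacity model (noise on the `7^k` data qubits only; flawless syndrome extraction); the level-`k` decoder is the
recursive ideal decoder of AGP06 §3.2 built from the level-1 sector decoder certified in `steaneSector_spec` (its identification with
sector-wise decoding of the level-`k` stabilizer code is the standard recursion, not re-derived from the `[[7^k,1,3^k]]` stabilizer
object here); sector-wise decoding ignores `X`/`Z` correlations; thresholds are LOWER bounds for this decoder; nothing circuit-level
(AGP06's exRec threshold `2.73 × 10⁻⁵` stays a named fact, `ThresholdTheorems.lean`).

## References

* [AliferisGottesmanPreskill2006] P. Aliferis, D. Gottesman, J. Preskill, Quantum Inf. Comput. 6 (2006) 97–165, §3.1–3.2, §7, §8.3.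
* [Gottesman1997] D. Gottesman, PhD thesis, arXiv:quant-ph/9705052, §3.5 (concatenated codes `[[n₁n₂, k, d₁d₂]]`).
* [DennisEtAl2002] E. Dennis, A. Kitaev, A. Landahl, J. Preskill, J. Math. Phys. 43 (2002) 4452, §4.1.
-/

noncomputable section

namespace Summit.Ventures.QEC.Thresholds

open Literature.InformationTheory.QuantumCodes Summit.Ventures.QEC.Census

/-! ### The code family: `[[7^k, 1, 3^k]]` from the census Steane row -/

/-- **The concatenated Steane family**: the census Steane row `cal_Steane7` (KERNEL-certified `[[7,1,3]]`, `CSSCode.IsCode`, read as a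
CRSS additive code by `CSSCode.IsCode.isAdditiveCode`) concatenated with itself `L` times gives a `[[7^(L+1), 1, 3^(L+1)]]` code
(Gottesman's concatenation theorem, iterated: the tree's `AdditiveCodeExists.concatPow`).
[cite: Gottesman1997, §3.5 (arXiv:quant-ph/9705052 chunk p0022 L93–100)] -/
theorem concatenatedSteane_exists (L : ℕ) : AdditiveCodeExists (7 ^ (L + 1)) 1 (3 ^ (L + 1)) :=
  (show AdditiveCodeExists 7 1 3 from ⟨_, (CSSCode.IsCode.isAdditiveCode cal_Steane7.isCode).1⟩).concatPow L

/-! ### The level-1 sector decoder is Hamming-syndrome decoding of the census Steane checks -/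

set_option maxRecDepth 8192 in
/-- **Specification of `AGP06.steaneSector` against the census Steane matrices** (kernel `decide`, all `2⁷` flip patterns): the
residual (flip back the position named by the Hamming syndrome) has even overlap with each of the three census check rows `cal_Steane7.cert.HZ` (zero syndrome: it lies in the sector's
normaliser), and `steaneSector b = true` iff the residual is NOT an `𝔽₂`-combination of the three census check rows `cal_Steane7.cert.HX`
(not a stabilizer of the sector, hence a logical operator: decoding the block leaves a logical flip).
[cite: AliferisGottesmanPreskill2006, §7; Gottesman1997, §3.5] -/
theorem steaneSector_spec : ∀ b : Fin 7 → Bool,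
    (∀ j : Fin 3, (Finset.univ.filter fun i : Fin 7 =>
        (if i.val + 1 = AGP06.hammingSyndrome b then !(b i) else b i) = true ∧
          (cal_Steane7.cert.HZ.getD j.val 0).testBit i.val = true).card % 2 = 0) ∧
    (AGP06.steaneSector b = true ↔
      ¬ ∃ c : Fin 3 → Bool, ∀ i : Fin 7, (if i.val + 1 = AGP06.hammingSyndrome b then !(b i) else b i) =
        ((c 0 && (cal_Steane7.cert.HX.getD 0 0).testBit i.val) ^^ (c 1 && (cal_Steane7.cert.HX.getD 1 0).testBit i.val) ^^
          (c 2 && (cal_Steane7.cert.HX.getD 2 0).testBit i.val))) := by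
  unfold AGP06.steaneSector AGP06.hammingSyndrome cal_Steane7.cert
  decide +kernel

/-! ### Thresholds of the family under hierarchical decoding (code-capacity model): failure probability → 0 -/

/-- Double-exponential bounds tend to zero: `0 ≤ f k ≤ C r^{2^k}` with `0 ≤ r < 1` forces `f k → 0`. [cite: AliferisGottesmanPreskill2006, Lemma 2] -/
theorem tendsto_zero_of_le_doubleExp {f : ℕ → ℝ} {C r : ℝ} (hC : 0 ≤ C) (hr0 : 0 ≤ r) (hr1 : r < 1)
    (h0 : ∀ k, 0 ≤ f k) (h : ∀ k, f k ≤ C * r ^ 2 ^ k) : Filter.Tendsto f Filter.atTop (nhds 0) := by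
  have hpow : Filter.Tendsto (fun k : ℕ => C * r ^ k) Filter.atTop (nhds 0) := by
    simpa using (tendsto_pow_atTop_nhds_zero_of_lt_one hr0 hr1).const_mul C
  refine squeeze_zero h0 (fun k => (h k).trans ?_) hpow
  exact mul_le_mul_of_nonneg_left (pow_le_pow_of_le_one hr0 hr1.le (Nat.lt_two_pow_self).le) hC

/-- **Per-sector threshold `1/21` for the concatenated Steane family** under hierarchical (level-by-level Hamming-syndrome) decoding,
code-capacity model: for independent flips of rate `0 ≤ p < 1/21` in one sector, the probability of a level-`k` logical flip tends to `0`
as `k → ∞` (indeed `≤ (1/21)(21p)^{2^k}`, `AGP06.flipProb_steaneSector_le`). [cite: AliferisGottesmanPreskill2006, Lemma 2 with §3.2 and §7] -/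
theorem concatenatedSteane_sector_threshold {p : ℝ} (hp0 : 0 ≤ p) (hp : p < 1 / 21) :
    Filter.Tendsto (fun k => AGP06.flipProb AGP06.steaneSector p k) Filter.atTop (nhds 0) := by
  refine tendsto_zero_of_le_doubleExp (C := 1 / 21) (r := 21 * p) (by norm_num) (by linarith) (by linarith) (fun k => ?_)
    (fun k => AGP06.flipProb_steaneSector_le hp0 hp.le k)
  unfold AGP06.flipProb
  refine Finset.sum_nonneg fun x _ => ?_
  split_ifs
  · exact AGP06.wt_nonneg hp0 (by linarith) k x
  · exact le_rfl

/-- **Depolarizing threshold `1/14` for the concatenated Steane family** under sector-wise hierarchical decoding, code-capacity model: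
for i.i.d. depolarizing noise of rate `0 ≤ p < 1/14`, the failure probability at level `k` tends to `0` as `k → ∞` (indeed
`≤ (2/21)(14p)^{2^k}`, `AGP06.depolFailProb_steane_le`). [cite: AliferisGottesmanPreskill2006, Lemma 2 with §3.2, §7 and §8.3; DennisEtAl2002, §4.1] -/
theorem concatenatedSteane_depolarizing_threshold {p : ℝ} (hp0 : 0 ≤ p) (hp : p < 1 / 14) :
    Filter.Tendsto (fun k => AGP06.depolFailProb AGP06.steaneSector p k) Filter.atTop (nhds 0) := by
  refine tendsto_zero_of_le_doubleExp (C := 2 / 21) (r := 14 * p) (by norm_num) (by linarith) (by linarith) (fun k => ?_)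
    (fun k => AGP06.depolFailProb_steane_le hp0 hp.le k)
  unfold AGP06.depolFailProb
  refine Finset.sum_nonneg fun E _ => ?_
  split_ifs
  · exact depolarizingProb_nonneg hp0 (by linarith) E
  · exact le_rfl

/-! ### The same thresholds in the tree's Q5 vocabulary (`IsThresholdLowerBound`, `accuracyThreshold`, `DecaysExponentially`)
(appended 2026-08-27, qec-type-03 g4: the concatenation rows read exactly like the toric rows, with the LEVEL `k` as the size index) -/

/-- The per-sector failure family of the concatenated Steane codes under hierarchical decoding: level `k`, flip rate `p`.
[cite: AliferisGottesmanPreskill2006, §3.2 and §7] -/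
def concatenatedSteaneSectorFamily : ℕ → ℝ → ℝ := fun k p => AGP06.flipProb AGP06.steaneSector p k

/-- The depolarizing failure family of the concatenated Steane codes under sector-wise hierarchical decoding: level `k`, rate `p`.
[cite: AliferisGottesmanPreskill2006, §3.2, §7 and §8.3] -/
def concatenatedSteaneDepolarizingFamily : ℕ → ℝ → ℝ := fun k p => AGP06.depolFailProb AGP06.steaneSector p k

/-- **`1/21` is a threshold lower bound** (tree vocabulary `IsThresholdLowerBound`) for one sector of the concatenated Steane family under
hierarchical decoding, code-capacity model. [cite: AliferisGottesmanPreskill2006, Lemma 2 with §3.2 and §7] -/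
theorem concatenatedSteane_sector_isThresholdLowerBound : IsThresholdLowerBound concatenatedSteaneSectorFamily (1 / 21) :=
  fun _ hp0 hp => concatenatedSteane_sector_threshold hp0 hp

/-- **`p_c ≥ 1/21`** for one sector of the concatenated Steane family under hierarchical decoding (code capacity).
[cite: AliferisGottesmanPreskill2006, Lemma 2 with §3.2 and §7] -/
theorem concatenatedSteane_sector_accuracyThreshold_ge : (1 / 21 : ℝ) ≤ accuracyThreshold concatenatedSteaneSectorFamily :=
  le_accuracyThreshold concatenatedSteane_sector_isThresholdLowerBound (by norm_num)

/-- **`1/14` is a threshold lower bound** (tree vocabulary) for the concatenated Steane family under i.i.d. depolarizing noise and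
sector-wise hierarchical decoding, code-capacity model. [cite: AliferisGottesmanPreskill2006, Lemma 2 with §3.2, §7 and §8.3] -/
theorem concatenatedSteane_depolarizing_isThresholdLowerBound :
    IsThresholdLowerBound concatenatedSteaneDepolarizingFamily (1 / 14) :=
  fun _ hp0 hp => concatenatedSteane_depolarizing_threshold hp0 hp

/-- **`p_c ≥ 1/14`** for the concatenated Steane family under depolarizing noise and sector-wise hierarchical decoding (code capacity).
[cite: AliferisGottesmanPreskill2006, Lemma 2 with §3.2, §7 and §8.3] -/
theorem concatenatedSteane_depolarizing_accuracyThreshold_ge :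
    (1 / 14 : ℝ) ≤ accuracyThreshold concatenatedSteaneDepolarizingFamily :=
  le_accuracyThreshold concatenatedSteane_depolarizing_isThresholdLowerBound (by norm_num)

/-- **Exponential (indeed double-exponential) decay in the level below threshold**, depolarizing noise: for `0 ≤ p ≤ 1/14`,
`|P k p| ≤ (2/21)·(14p)^k` (tree vocabulary `DecaysExponentially`, from the sharper `(14p)^{2^k}`).
[cite: AliferisGottesmanPreskill2006, Lemma 2 ("declines double-exponentially with k")] -/
theorem concatenatedSteane_depolarizing_decaysExponentially {p : ℝ} (hp0 : 0 ≤ p) (hp : p < 1 / 14) :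
    DecaysExponentially concatenatedSteaneDepolarizingFamily p := by
  refine ⟨2 / 21, 14 * p, by linarith, by linarith, fun k => ?_⟩
  have hnn : 0 ≤ AGP06.depolFailProb AGP06.steaneSector p k := by
    unfold AGP06.depolFailProb
    refine Finset.sum_nonneg fun E _ => ?_
    split_ifs
    · exact depolarizingProb_nonneg hp0 (by linarith) E
    · exact le_rfl
  show |AGP06.depolFailProb AGP06.steaneSector p k| ≤ 2 / 21 * (14 * p) ^ k
  rw [abs_of_nonneg hnn]
  refine (AGP06.depolFailProb_steane_le hp0 hp.le k).trans ?_
  exact mul_le_mul_of_nonneg_left (pow_le_pow_of_le_one (by linarith) (by linarith) (Nat.lt_two_pow_self).le) (by norm_num)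

end Summit.Ventures.QEC.Thresholds

end
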